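import Literature.Computability.QuantumComplexity.Lemma24Transcribe
import Literature.Computability.QuantumComplexity.Lemma24Branches
import Literature.Computability.QuantumComplexity.Lemma24Main
import Literature.Computability.QuantumComplexity.WireConjugation
import HarnessLib

/-!
# Aaronson–Ambainis Lemma 24 over the sign basis, IX: one block of the reduction

Ninth file of the discharge of `AaronsonAmbainis2018_lemma24_sign_hard` (plan in
`Lemma24Catalysis.lean`): the sign-basis circuit of ONE block and its transition amplitude. For a
Clifford+`T` circuit `C` on `n + m` wires and an input `x`, with `K = Kw (n + m)` working wires
(file VIII), the block circuit on `K + 2 + 1` wires is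

  `blockCircuit C x = copyTrick (gadgetR K ++ transcribe (mainGates C x)) flag fresh`

— prepare the (approximate, realified) magic state on `(cat, ρ, hlp)` by the fixed gadget (file III),
run the transcription of the working circuit (file VII), and read the flag by the copy trick
(file IV). Chaining the files:

* `toMatrix_gadgetR_mulVec_zero` — the gadget writes `reVec (|0…0⟩ ⊗ γ)` (file III read through files II, VI);
* the state before the copy is `reVec (injProd ⬝ (|0⟩ ⊗ γ))` (file VII), the weight of the flag is the
  same on the real and on the complex side (file II), `injProd` splits along `Π_A + Π_⊥` into
  `|mainState⟩ ⊗ Π_A γ + |Θ_ZT⟩ ⊗ Π_⊥ γ` (files I, VII), and the branch split (file VI) with the flag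
  weight of the working state (file VIII) give
  **`signAmplitude_blockCircuit`**:
  `A = ‖Π_A γ‖² · (1 − (1 − p)^4) + ‖Π_⊥ γ‖² · J` for some `J ∈ [0, 1]`, `p = C.acceptProb 0 x`;
* hence the two-sided bounds `signAmplitude_blockCircuit_ge` (`p ≥ 2/3 ⇒ A ≥ 197/250`... precisely
  `A ≥ (997/1000)(80/81)`) and `signAmplitude_blockCircuit_le` (`p ≤ 1/3 ⇒ A ≤ 65/81 + 3/1000`),
  oracle-freeness and the size of the block circuit.

## References

* S. Aaronson, A. Ambainis, *Forrelation*, SIAM J. Comput. 47 (2018), §6, Lemma 24 (p. 26).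
* M. A. Nielsen, I. L. Chuang, *Quantum Computation and Quantum Information*, CUP 2010, §2.2.8,
  §3.2.5, §10.6.2.
* E. Bernstein, U. Vazirani, *Quantum complexity theory*, SIAM J. Comput. 26 (1997), §8.
-/

noncomputable section

namespace Literature.Computability.QuantumComplexity

open Matrix _root_.Computability Complexity Cryptography Finset

namespace Lemma24

variable {K : ℕ}

/-! ### The gadget on `(cat, ρ, hlp)` -/

/-- The catalyst and the helper are distinct complex wires. [folklore] -/
theorem catC_ne_hlpC (K : ℕ) : catC K ≠ hlpC K := by
  intro h; have := congrArg Fin.val h; simp at this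

/-- The placement of the gadget: its wires `0, 1, 2` go to `cat`, `ρ`, `hlp` (the gadget's middle wire is
the real/imaginary wire, which the real register keeps last). [cite: NielsenChuang2010, §10.6.2] -/
def gadEmb (K : ℕ) : Fin 3 ↪ Fin (K + 2 + 1) :=
  tripleEmb (rl (catC K)) (rho K) (rl (hlpC K)) (rl_ne_rho _) (fun h => catC_ne_hlpC K (rl_injective h))
    (rl_ne_rho _).symm

/-- The gadget gates on the real register. [cite: AaronsonAmbainis2018, §6 Lemma 24 (p. 26)] -/
def gadgetR (K : ℕ) : List (QGate hSign (K + 2 + 1)) := (mapWires (gadEmb K) gadget).gates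

/-- The gadget gates are oracle-free. [folklore] -/
theorem gadgetR_isOracleFree (K : ℕ) : ∀ g ∈ gadgetR K, g.IsOracleFree :=
  isOracleFree_mapWires (gadEmb K) gadget_isOracleFree

/-- The gadget gates act on `cat`, `ρ`, `hlp` only. [folklore] -/
theorem mem_wires_gadgetR {g : QGate hSign (K + 2 + 1)} (hg : g ∈ gadgetR K) {q : Fin (K + 2 + 1)} (hq : q ∈ g.wires) :
    q = rl (catC K) ∨ q = rho K ∨ q = rl (hlpC K) := by
  simp only [gadgetR, gates_mapWires, List.mem_map] at hg
  obtain ⟨g', -, rfl⟩ := hg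
  obtain ⟨j, hj⟩ := wires_mapWiresGate_subset (gadEmb K) g' _ hq
  fin_cases j
  · exact Or.inl hj.symm
  · exact Or.inr (Or.inl hj.symm)
  · exact Or.inr (Or.inr hj.symm)

/-- Restriction of a real label to the gadget wires. [folklore] -/
theorem comp_gadEmb (z : QReg (K + 2 + 1)) : z ∘ gadEmb K = ![z (rl (catC K)), z (rho K), z (rl (hlpC K))] := by
  funext j; fin_cases j <;> rfl

/-- Off the gadget wires are exactly the real images of the working wires. [folklore] -/
theorem forall_off_gadEmb_iff (z : QReg (K + 2 + 1)) :
    (∀ q, q ∉ Set.range (gadEmb K) → z q = false) ↔ ∀ i : Fin K, z (rl (wk i)) = false := by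
  constructor
  · intro h i
    refine h _ ?_
    rintro ⟨j, hj⟩
    fin_cases j
    · exact wk_ne_catC i (rl_injective hj).symm
    · exact rl_ne_rho _ hj.symm
    · have : wk i ≠ hlpC K := by intro h'; have := congrArg Fin.val h'; have := i.isLt; simp at *; omega
      exact this (rl_injective hj).symm
  · intro h q hq
    induction q using Fin.lastCases with
    | last => exact absurd ⟨1, rfl⟩ hq
    | cast j =>
      induction j using Fin.addCases with
      | left i => exact h i
      | right l =>
        fin_cases l
        · exact absurd ⟨0, rfl⟩ hq
        · exact absurd ⟨2, rfl⟩ hq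

/-- **The gadget writes the realification of `|0…0⟩ ⊗ γ`.** [cite: NielsenChuang2010, §10.6.2] -/
theorem toMatrix_gadgetR_mulVec_zero (K : ℕ) :
    (⟨gadgetR K⟩ : QCircuit hSign (K + 2 + 1)).toMatrix 0 *ᵥ basisState (fun _ => false) =
      reVec (tensorVec (basisState (fun _ : Fin K => false)) gamma) := by
  have hmat : (⟨gadgetR K⟩ : QCircuit hSign (K + 2 + 1)).toMatrix 0 = placeGate (gadEmb K) (gadget.toMatrix 0) :=
    toMatrix_mapWires (gadEmb K) 0 gadget
  rw [hmat]
  refine vec_ext_snoc fun z' t => ?_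
  rw [reVec_snoc, placeGate_mulVec_basisState_apply, tensorVec_apply, basisState_apply]
  have hcomp : ((fun _ => false : QReg (K + 2 + 1)) ∘ gadEmb K) = fun _ => false := rfl
  have hG : ∀ u, (gadget.toMatrix 0) u (fun _ => false) = gadgetVec u := fun u => by
    rw [← gadget_mulVec_zero, mulVec_basisState]
  rw [hcomp, hG, comp_gadEmb]
  simp only [Fin.snoc_castSucc, Fin.snoc_last]
  by_cases hoff : ∀ i : Fin K, (Fin.snoc z' t : QReg (K + 2 + 1)) (rl (wk i)) = false
  · -- clean working wires: the gadget entry, read as re/im of `γ`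
    have hz : (fun i => z' (Fin.castAdd 2 i)) = fun _ => false := by
      funext i; have := hoff i; simpa using this
    rw [if_pos ((forall_off_gadEmb_iff _).2 hoff), hz, if_pos rfl, one_mul, gadgetVec_eq_gamma]
    have hy : (fun j => z' (Fin.natAdd K j)) = ![z' (catC K), z' (hlpC K)] := by
      funext j; fin_cases j <;> rfl
    rw [hy]
    cases t <;> simp [vecEntry]
  · -- a working wire is set: both sides vanish
    rw [if_neg (fun h => hoff ((forall_off_gadEmb_iff _).1 h))]
    have hz : (fun i => z' (Fin.castAdd 2 i)) ≠ fun _ => false := by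
      intro h
      apply hoff
      intro i
      have := congrFun h i
      simpa using this
    rw [if_neg hz, zero_mul, vecEntry_zero]

/-! ### The block circuit -/

variable {n m : ℕ}

/-- The flag and the fresh wire are distinct working wires. [folklore] -/
theorem flagW_ne_freshW (w : ℕ) : flagW w ≠ freshW w := fun h => by have := congrArg Fin.val h; simp at this

/-- **The gates of a block before the copy**: the gadget, then the transcription of the working circuit.
[cite: AaronsonAmbainis2018, §6 Lemma 24 (p. 26)] -/
def blockReal (C : QCircuit cliffordT (n + m)) (x : QReg n) : List (QGate hSign (Kw (n + m) + 2 + 1)) :=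
  gadgetR (Kw (n + m)) ++ transcribe (mainGates C x)

/-- **The block circuit**: the copy trick around `blockReal`, flag `rl (wk flagW)`, fresh wire
`rl (wk freshW)`. [cite: AaronsonAmbainis2018, §6 Lemma 24 (p. 26)] -/
def blockCircuit (C : QCircuit cliffordT (n + m)) (x : QReg n) : QCircuit hSign (Kw (n + m) + 2 + 1) :=
  copyTrick (blockReal C x) (rl (wk (flagW (n + m)))) (rl (wk (freshW (n + m))))
    (fun h => flagW_ne_freshW _ (Fin.castAdd_injective _ _ (rl_injective h)))

/-- The gates before the copy are oracle-free. [folklore] -/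
theorem blockReal_isOracleFree {C : QCircuit cliffordT (n + m)} (x : QReg n) : ∀ g ∈ blockReal C x, g.IsOracleFree := by
  intro g hg
  rcases List.mem_append.1 hg with hg | hg
  · exact gadgetR_isOracleFree _ g hg
  · exact transcribe_isOracleFree _ g hg

/-- **The fresh wire is untouched before the copy.** [folklore] -/
theorem freshR_not_mem_wires_blockReal (C : QCircuit cliffordT (n + m)) (x : QReg n) :
    ∀ g ∈ blockReal C x, rl (wk (freshW (n + m))) ∉ g.wires := by
  intro g hg hq
  rcases List.mem_append.1 hg with hg | hg
  · rcases mem_wires_gadgetR hg hq with h | h | h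
    · exact wk_ne_catC _ (rl_injective h)
    · exact rl_ne_rho _ h
    · have : wk (freshW (n + m)) ≠ hlpC (Kw (n + m)) := by
        intro h'; have := congrArg Fin.val h'; simp [Kw] at this
      exact this (rl_injective h)
  · rcases mem_wires_transcribe hg hq with h | h | ⟨g', hg', i, hi, h⟩
    · exact rl_ne_rho _ h
    · exact wk_ne_catC _ (rl_injective h)
    · have : i = freshW (n + m) := (Fin.castAdd_injective _ _ (rl_injective h)).symm
      subst this
      exact freshW_not_mem_wires_mainGates C x g' hg' hi

/-- The block circuit is oracle-free. [folklore] -/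
theorem blockCircuit_isOracleFree (C : QCircuit cliffordT (n + m)) (x : QReg n) : (blockCircuit C x).IsOracleFree :=
  copyTrick_isOracleFree (blockReal_isOracleFree x) _ _ _

/-- Size of the block circuit: linear in the size of `C` and in `n`. [folklore] -/
theorem size_blockCircuit_le (C : QCircuit cliffordT (n + m)) (x : QReg n) :
    (blockCircuit C x).size ≤ 56 * C.size + 1344 * n + 2744 := by
  rw [blockCircuit, size_copyTrick, blockReal, List.length_append]
  have h1 : (gadgetR (Kw (n + m))).length = 25 := by simp [gadgetR, gadget, gadgetOps]
  have h2 := length_transcribe_le (mainGates C x)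
  have h3 := length_mainGates_le C x
  omega

/-! ### The state before the copy, and the amplitude -/

/-- The state before the copy is the realification of the injection reading applied to `|0…0⟩ ⊗ γ`.
[cite: AaronsonAmbainis2018, §6 Lemma 24 (p. 26)] -/
theorem blockReal_state {C : QCircuit cliffordT (n + m)} (hC : C.IsOracleFree) (x : QReg n) :
    (⟨blockReal C x⟩ : QCircuit hSign (Kw (n + m) + 2 + 1)).toMatrix 0 *ᵥ basisState (fun _ => false) =
      reVec (injProd (mainGates C x) *ᵥ tensorVec (basisState (fun _ : Fin (Kw (n + m)) => false)) gamma) := by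
  have e1 : (⟨blockReal C x⟩ : QCircuit hSign (Kw (n + m) + 2 + 1)) =
      (⟨gadgetR (Kw (n + m))⟩ : QCircuit hSign _).append ⟨transcribe (mainGates C x)⟩ := rfl
  rw [e1, QCircuit.toMatrix_append, ← Matrix.mulVec_mulVec, toMatrix_gadgetR_mulVec_zero,
    toMatrix_transcribe _ (mainGates_isOracleFree hC x), reOp_mulVec_reVec]

/-- The projectors on the catalyst, through the last two complex wires. [folklore] -/
theorem projAt_catC_eq (P : Matrix (QReg 1) (QReg 1) ℂ) :
    placeGate (wireEmb (catC K)) P = placeGate (Fin.natAddEmb K) (placeGate (wireEmb (0 : Fin 2)) P) := by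
  rw [placeGate_placeGate, wireEmb_trans]; rfl

/-- **The injection reading splits `|0⟩ ⊗ γ` along the catalyst branches**:
`injProd (|0⟩ ⊗ γ) = |mainState⟩ ⊗ Π_A γ + |M 0⟩ ⊗ Π_⊥ γ`, where `M` is the `ZT`-reading of the working
circuit. [cite: NielsenChuang2010, §10.6.2] -/
theorem injProd_tensor_split {C : QCircuit cliffordT (n + m)} (hC : C.IsOracleFree) (x : QReg n)
    {M : Matrix (QReg (Kw (n + m))) (QReg (Kw (n + m))) ℂ} (hM : ztProd (mainGates C x) = placeGate (Fin.castAddEmb 2) M) :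
    injProd (mainGates C x) *ᵥ tensorVec (basisState (fun _ : Fin (Kw (n + m)) => false)) gamma =
      tensorVec (mainState C x) branchA + tensorVec (M *ᵥ basisState (fun _ => false)) branchPerp := by
  have hgs := mainGates_isOracleFree hC x
  -- insert `Π_A + Π_⊥ = 1`
  have hsplit : tensorVec (basisState (fun _ : Fin (Kw (n + m)) => false)) gamma =
      projAAt (catC (Kw (n + m))) *ᵥ tensorVec (basisState (fun _ : Fin (Kw (n + m)) => false)) gamma +
        projAperpAt (catC (Kw (n + m))) *ᵥ tensorVec (basisState (fun _ : Fin (Kw (n + m)) => false)) gamma := by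
    rw [← Matrix.add_mulVec, ← branchA_add_branchPerp.placeGate_add, projA_add_projAperp, placeGate_one, Matrix.one_mulVec]
  conv_lhs => rw [hsplit]
  rw [Matrix.mulVec_add, Matrix.mulVec_mulVec, Matrix.mulVec_mulVec, injProd_mul_projA _ hgs, injProd_mul_projAperp _ hgs,
    tProd_eq, hM]
  simp only [projAAt, projAperpAt]
  rw [← placeGate_comm_wire (catC_not_mem_range_castAddEmb _) _ projA,
    ← placeGate_comm_wire (catC_not_mem_range_castAddEmb _) _ projAperp, ← Matrix.mulVec_mulVec, ← Matrix.mulVec_mulVec,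
    projAt_catC_eq projA, projAt_catC_eq projAperp, placeGate_natAddEmb_mulVec_tensorVec, placeGate_natAddEmb_mulVec_tensorVec,
    placeGate_castAddEmb_mulVec_tensorVec, placeGate_castAddEmb_mulVec_tensorVec]
  rfl

/-- **The transition amplitude of a block**: `A = ‖Π_A γ‖² · (1 − (1 − p)^4) + ‖Π_⊥ γ‖² · J` for some
`J ∈ [0, 1]` (the flag weight of the `ZT`-branch), `p = C.acceptProb 0 x`.
[cite: AaronsonAmbainis2018, §6 Lemma 24 (p. 26)] -/
theorem signAmplitude_blockCircuit {C : QCircuit cliffordT (n + m)} (hC : C.IsOracleFree) (x : QReg n) :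
    ∃ J : ℝ, 0 ≤ J ∧ J ≤ 1 ∧ signAmplitude (blockCircuit C x) =
      normSq branchA * (1 - (1 - C.acceptProb 0 x) ^ 4) + normSq branchPerp * J := by
  obtain ⟨M, hMu, hM⟩ := ztProd_eq (mainGates C x)
  set θ : QReg (Kw (n + m)) → ℂ := M *ᵥ basisState (fun _ : Fin (Kw (n + m)) => false) with hθ
  have hθ1 : normSq θ = 1 := by rw [hθ, normSq_mulVec_of_mem_unitaryGroup hMu, normSq_basisState]
  refine ⟨∑ u, if u (flagW (n + m)) = true then ‖θ u‖ ^ 2 else 0,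
    Finset.sum_nonneg fun u _ => by split_ifs <;> positivity, ?_, ?_⟩
  · calc (∑ u, if u (flagW (n + m)) = true then ‖θ u‖ ^ 2 else 0) ≤ ∑ u, ‖θ u‖ ^ 2 :=
          Finset.sum_le_sum fun u _ => by split_ifs <;> first | exact le_rfl | positivity
      _ = 1 := hθ1
  · have hne : rl (wk (flagW (n + m))) ≠ rl (wk (freshW (n + m))) :=
      fun h => flagW_ne_freshW _ (Fin.castAdd_injective _ _ (rl_injective h))
    have hA := signAmplitude_copyTrick (blockReal_isOracleFree (C := C) x) hne (freshR_not_mem_wires_blockReal C x)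
    rw [blockReal_state hC x, injProd_tensor_split hC x hM] at hA
    -- the weight of the flag: real side = complex side = branch split
    set Ψ := tensorVec (mainState C x) branchA + tensorVec θ branchPerp with hΨ
    have hrealR : (∑ z : QReg (Kw (n + m) + 2 + 1), if Fin.init z (wk (flagW (n + m))) = true then ‖reVec Ψ z‖ ^ 2 else 0) =
        normSq branchA * (∑ u, if u (flagW (n + m)) = true then ‖mainState C x u‖ ^ 2 else 0) +
          normSq branchPerp * (∑ u, if u (flagW (n + m)) = true then ‖θ u‖ ^ 2 else 0) := by
      rw [hΨ, ← sum_ite_normSq_tensorVec_add (mainState C x) θ sum_star_branchA_mul_branchPerp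
        (fun u => u (flagW (n + m)) = true)]
      exact sum_ite_norm_sq_reVec _ (fun u => u (wk (flagW (n + m))) = true)
    have hfin : (signAmplitude (blockCircuit C x) : ℂ) =
        ((normSq branchA * (∑ u, if u (flagW (n + m)) = true then ‖mainState C x u‖ ^ 2 else 0) +
          normSq branchPerp * (∑ u, if u (flagW (n + m)) = true then ‖θ u‖ ^ 2 else 0) : ℝ) : ℂ) := by
      rw [← hrealR, Complex.ofReal_sum]
      refine hA.trans (Finset.sum_congr rfl fun z _ => ?_)
      by_cases h : z (rl (wk (flagW (n + m)))) = true
      · rw [if_pos h, if_pos (show Fin.init z (wk (flagW (n + m))) = true from h)]; push_cast; rfl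
      · rw [if_neg h, if_neg (show ¬ Fin.init z (wk (flagW (n + m))) = true from h)]; push_cast; rfl
    rw [flagWeight_mainState C x] at hfin
    exact_mod_cast hfin

/-- **Yes-side bound**: if `C` accepts `x` with probability `≥ 2/3` then `A ≥ (997/1000)(80/81)`.
[cite: AaronsonAmbainis2018, §6 Lemma 24 (p. 26)] -/
theorem signAmplitude_blockCircuit_ge {C : QCircuit cliffordT (n + m)} (hC : C.IsOracleFree) {x : QReg n}
    (hp : 2 / 3 ≤ C.acceptProb 0 x) (hp1 : C.acceptProb 0 x ≤ 1) :
    (997 : ℝ) / 1000 * (80 / 81) ≤ signAmplitude (blockCircuit C x) := by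
  obtain ⟨J, hJ0, -, hA⟩ := signAmplitude_blockCircuit hC x
  rw [hA]
  have h1 := or_amplify_ge hp hp1
  have h2 := normSq_branchA_ge
  have h3 : 0 ≤ normSq branchPerp := normSq_nonneg' _
  nlinarith

/-- **No-side bound**: if `C` accepts `x` with probability `≤ 1/3` then `0 ≤ A ≤ 65/81 + 3/1000`.
[cite: AaronsonAmbainis2018, §6 Lemma 24 (p. 26)] -/
theorem signAmplitude_blockCircuit_le {C : QCircuit cliffordT (n + m)} (hC : C.IsOracleFree) {x : QReg n}
    (hp : C.acceptProb 0 x ≤ 1 / 3) (hp0 : 0 ≤ C.acceptProb 0 x) :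
    signAmplitude (blockCircuit C x) ≤ (65 : ℝ) / 81 + 3 / 1000 := by
  obtain ⟨J, hJ0, hJ1, hA⟩ := signAmplitude_blockCircuit hC x
  rw [hA]
  have h1 := or_amplify_le hp
  have h1' := or_amplify_nonneg hp0 (by linarith) 4
  have h2 := normSq_branchPerp_le
  have h3 : normSq branchA ≤ 1 := by have := normSq_branchA_add; have := normSq_nonneg' branchPerp; linarith
  have h4 : 0 ≤ normSq branchA := normSq_nonneg' _
  have h5 : 0 ≤ normSq branchPerp := normSq_nonneg' _
  nlinarith

/-- The amplitude of a block is nonnegative. [cite: AaronsonAmbainis2018, §6 Lemma 24 (p. 26)] -/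
theorem signAmplitude_blockCircuit_nonneg {C : QCircuit cliffordT (n + m)} (hC : C.IsOracleFree) {x : QReg n}
    (hp0 : 0 ≤ C.acceptProb 0 x) (hp1 : C.acceptProb 0 x ≤ 1) : 0 ≤ signAmplitude (blockCircuit C x) := by
  obtain ⟨J, hJ0, -, hA⟩ := signAmplitude_blockCircuit hC x
  rw [hA]
  have h1 := or_amplify_nonneg hp0 hp1 4
  have h4 : 0 ≤ normSq branchA := normSq_nonneg' _
  have h5 : 0 ≤ normSq branchPerp := normSq_nonneg' _
  positivity

end Lemma24

end Literature.Computability.QuantumComplexity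

end
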